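import Summits.BirchSwinnertonDyer.BirchSwinnertonDyer.Theorems.UniversalToricDescentTwinHowardConclusion
import Summits.BirchSwinnertonDyer.BirchSwinnertonDyer.Theorems.UniversalToricDescentTwinSatisfiesHAtThree
import Summits.BirchSwinnertonDyer.BirchSwinnertonDyer.Theorems.PrintX9MuPartStubAHowardInputsOfClauses
import Literature.NumberTheory.EllipticCurves.Castella2024.LambdaAdicHeegnerClass
import Literature.NumberTheory.GaloisCohomology.Howard2004.DVRKolyvaginBound
import HarnessLib

/-!
# K2a of skeleton v11 REDUCED TO ITS RESEARCH CORE: the Kolyvagin-system LINK letter for the twin `Stmt.ksLinkMultAt p` and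
# `twin_conclusionAtControlLevels_of_ksLink` — F-161′ + the link ⟹ `Stmt.conclusionAtControlLevels 3 …` (SatisfiesH, LargePrimes PROVED)

Summits-side helper toward the registered stub `stub_howardConclusionOfFamily` (K2a) of line `beta-road` (skeleton v11
7470d22ca8631dc9) of crux r205 stmt-BirchSwinnertonDyer-24737 `…Theses.UniversalToricDescent.TwinAlgMuZeroAtThree` (LEAD lineage
`bsd-wall-utd-p1`, g26; `--supports`).  ROUTE-INDEPENDENT; ONE statement abbreviation (a letter, nothing asserted) and ONE theorem; no
named fact introduced (F-161′ `Howard2004.thm161_dvrKolyvaginBound` is a HYPOTHESIS of the theorem, by name), no instance, no `sorry`.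

K2a asks, for the K1 Heegner family `F` of the twin, for a `Λ`-adic Selmer datum `Dat`, the `Λ`-adic Heegner class `z` of `F` and
`Stmt.conclusionAtControlLevels 3 N′ W′ K κ γ hγ hE Dat z` (Howard's `Conclusion` at the control levels of `z`, all large `m`).  Cell
x9's D1 chain `HeegnerMuPartStubA.howardInputs_of_clauses` (p673958) produces exactly this on the print frame from four inputs:
Poitou–Tate (kernel theorem), H.4 and H.5(b) at `v ∈ S` (for the twin: PROVED, g25 `…TwinSatisfiesHAtThree.exists_satisfiesH_levelsTame_of_mult_three`,
p761918), and the KOLYVAGIN-SYSTEM LINK `Stmt.ksLink` (the KS side chooses `S`, the pins `π`, the primes `𝓛 ⊇ 𝓛_{s₁} ∖ S`, the tower pin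
`(t, ht, I)`, `jbar′`, and for any conjugation datum / H.4 data / `hy` returns `κ^{KS}` with `κ₁ =` the control image of the class,
non-zero) — then `LargePrimes` (generic `eisensteinDVRSetting_largePrimes`) and Thm. 1.6.1.  This file:
* `Stmt.ksLinkMultAt p` — x9's `Stmt.ksLink` ON THE TWIN FRAME at a fixed prime, in the K2 stub's currency: the class is the `Λ`-adic
  Heegner class `z` of a Heegner family `F` (`IsLambdaAdicHeegnerClass Dat F α z`, Manin constant prime to `p`, `α² = 1`, norm-coherent)
  with `z ≠ 0`, instead of CGLS's stabilised class; the print-frame binders (`Thm413Hypotheses`, `¬CM`, MZ26 scalars, `p ∣ h_K`) replaced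
  by the twin frame.  THIS is the research residue «KS-twin»: the Heegner-point Kolyvagin system for the levels-tame Eisenstein settings of
  a curve with MULTIPLICATIVE reduction at `p` (`p = 3`, `3 ∥ N′`; Howard 2004 §2.3 / CGLS Thm. 4.1.1 assume `p ∤ N`; Howard 2007 `p ∤ 6N`).
* **`twin_conclusionAtControlLevels_of_ksLink`** — in the binders of crux 24737: F-161′ → `Stmt.ksLinkMultAt 3` → for the family `F` and
  its class `z ≠ 0` in `Dat`: `Stmt.conclusionAtControlLevels 3 N′ W′ K κ γ hγ hE Dat z`.  x9's `obtain` chain with the twin's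
  `SatisfiesH` theorem and the generic `LargePrimes`; the link `κ₁ k = I.proj (k+1) (f_m z)` turns `Conclusion hy κ₁` into the predicate.
So K2a = E1 (datum + class, generic) + `z ≠ 0` (K1 + E6, in the skeleton) + F-161′ (x9's G87 engine debt) + `Stmt.ksLinkMultAt 3` (research).
No summit statement is proved; BSD is not proved by any of this.

References: [Howard2004HeegnerKolyvagin] §1.3, Thm. 1.6.1, §1.7, §2.3, Prop. 2.2.8, proof of Thm. 2.2.10; [CastellaGrossiLeeSkinner2022]
Thm. 4.1.1, §3.4; [BertoliniDarmon1996] §2.5.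
-/

set_option linter.dupNamespace false
set_option autoImplicit false

noncomputable section

open scoped Classical Pointwise ContRepresentation TensorProduct NumberField

open Function NumberField IsDedekindDomain Field
open Literature Literature.NumberTheory.EllipticCurves WeierstrassCurve
open Literature.NumberTheory.GaloisCohomology Literature.NumberTheory.GaloisCohomology.Howard2004
open Literature.NumberTheory.Automorphic
open Literature.NumberTheory.EllipticCurves.ZpExtension (EisensteinLevel)
open Literature.NumberTheory.GaloisRepresentations Literature.NumberTheory.GaloisRepresentations.DiscreteGaloisModule
open Literature.NumberTheory.EllipticCurves.Castella2024
open Summit.BirchSwinnertonDyer.BirchSwinnertonDyer.Theorems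
open Summit.BirchSwinnertonDyer.BirchSwinnertonDyer.Theorems.UniversalToricDescentTwinHowardConclusion

namespace Summit.BirchSwinnertonDyer.BirchSwinnertonDyer.Theorems.UniversalToricDescentTwinHowardConclusionOfKS

/-! ## §1 The Kolyvagin-system link letter on the twin frame -/

set_option synthInstance.maxHeartbeats 80000 in
/-- **Letter `Stmt.ksLinkMultAt p` — the Kolyvagin system with the LINK, on the twin frame** (x9's `Stmt.ksLink` with the print
frame replaced and the class = the `Λ`-adic Heegner class of a Heegner family): for `W/ℚ` elliptic, `K` imaginary quadratic, `p ≠ 2`,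
`κ` anticyclotomic, Heegner for `N`, `γ` a topological generator, `E(K)[p] = 0`, multiplicative reduction of `W_K` above `p`, a
Heegner family `F` with Manin constant prime to `p`, a sign `α` (`α² = 1`) with `F` norm-coherent, a `Λ`-adic Selmer datum `Dat` and
the `Λ`-adic Heegner class `z ≠ 0` of `F` in it: the KS side chooses the place set `S` (above `p`, inside the places above `pN`,
`Aut(K/ℚ)`-stable), a threshold `m₁`, and for every `m ≥ m₁` the pins `π`, the primes `𝓛` (off `S`, degree two, containing
`𝓛_{s₁} ∖ S`), the tower pin `(t, ht, I)` and `jbar′`, and then for ANY conjugation datum, H.4 data and `hy` a Kolyvagin system `κ^{KS}`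
for the levels-tame setting with `κ₁ ≠ 0` and `κ₁ k = I.proj (k+1) (f_m z)`.  A LETTER (hypothesis shape; Howard §1.7/§2.3, CGLS §3.4 at
`p ∤ N` — beyond print at a multiplicative `p`); nothing is asserted. -/
abbrev Stmt.ksLinkMultAt (p : ℕ) [Fact p.Prime] : Prop :=
  ∀ (N : ℕ) [NeZero N] (W : WeierstrassCurve ℚ) [W.IsElliptic] [W.IsGloballyMinimal] (K : Type) [Field K] [NumberField K]
    (κ : ZpExtension K p) (γ : Field.absoluteGaloisGroup K),
    IsImaginaryQuadratic K → p ≠ 2 → κ.IsAnticyclotomic → SatisfiesHeegnerHypothesis N K →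
    ∀ (hγ : κ.IsTopGenerator γ) (hE : ∀ Q : (W.baseChange K).toAffine.Point, p • Q = 0 → Q = 0),
    (∀ v : IsDedekindDomain.HeightOneSpectrum (NumberField.RingOfIntegers K),
      ((p : ℕ) : NumberField.RingOfIntegers K) ∈ v.asIdeal → (W.baseChange K).HasMultiplicativeReductionAt v) →
    ∀ (jbar : AlgebraicClosure K →+* ℂ) (F : HeegnerFamily N W K κ jbar) (α : ℤ),
      ¬ (p : ℤ) ∣ F.Dt.c → α ^ 2 = 1 → F.IsNormCompatible γ α →
    ∀ (D : (W.baseChange K).LambdaAdicSelmerData κ γ) (z : D.S),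
      IsLambdaAdicHeegnerClass D F α z → z ≠ 0 →
    ∃ (S : Finset (HeightOneSpectrum (𝓞 K)))
      (hpS : ∀ v, ((p : ℕ) : 𝓞 K) ∈ v.asIdeal → v ∈ S)
      (hbad : ∀ v, v ∉ S → ((p : ℕ) : 𝓞 K) ∉ v.asIdeal → (W.baseChange K).HasGoodReductionAt v)
      (_hSN : ∀ v ∈ S, ((p : ℕ) : 𝓞 K) ∈ v.asIdeal ∨ ((N : ℕ) : 𝓞 K) ∈ v.asIdeal)
      (_hSσ : ∀ (σ : K ≃ₐ[ℚ] K) (v : HeightOneSpectrum (𝓞 K)), σ • v ∈ S → v ∈ S)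
      (m₁ : ℕ), ∀ (m : ℕ) (hm : 1 ≤ m), m₁ ≤ m →
      letI := IwasawaAlgebra.isDomain_quotient_X_pow_add_C p hm
      letI := IwasawaAlgebra.isDiscreteValuationRing_quotient_X_pow_add_C p hm
      haveI := IwasawaAlgebra.EisensteinCoeff.isLocalRing_succ p hm
      letI := IwasawaAlgebra.EisensteinCoeff.algebraOfSpecSucc p m
      haveI := W.isScalarTower_algebraOfSpecSucc (K := K) (p := p) (m := m)
      letI := W.residueModuleSucc (K := K) (p := p) hm
      ∃ (π : ∀ v : HeightOneSpectrum (𝓞 K), TamePin v) (L : Set (HeightOneSpectrum (𝓞 K)))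
        (hL : L ⊆ (W.eisensteinTower (κ.unitTwist (-1)) hm).degreeTwoPrimes p) (hLS : ∀ v ∈ L, v ∉ S)
        (s₁ : ℕ) (_hsub : ∀ v ∈ (W.eisensteinTower (κ.unitTwist (-1)) hm).kolyvaginPrimes p s₁, v ∉ S → v ∈ L)
        (t : ∀ k, ((W.baseChange K).torsionGaloisModule ((p : ℤ) ^ (k + 1))).toContRepresentation →ⁱL
          ((W.baseChange K).torsionGaloisModule ((p : ℤ) ^ k)).toContRepresentation)
        (ht : ∀ k (P : geomTorsion (W.baseChange K) ((p : ℤ) ^ (k + 1))),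
          t k P = (W.baseChange K).geomTorsionReduce p k P)
        (I : ZpExtension.EisensteinH1Data (κ.unitTwist (-1))
          (fun k ↦ (W.baseChange K).torsionGaloisModule ((p : ℤ) ^ k)) t hm)
        (jbar' : AlgebraicClosure K →+* ℂ),
        ∀ (cd : ConjugationDatum K)
          (Dd : ∀ k, DualityDatum p cd ((W.eisensteinTower (κ.unitTwist (-1)) hm).ρ k)
            (IwasawaAlgebra.EisensteinCoeff p m (k + 1)))
          (hy : (W.eisensteinDVRSettingLevelsTame (κ.unitTwist (-1)) hm π S hpS hbad L hL hLS jbar' cd Dd).SatisfiesH),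
          ∃ κKS : (W.eisensteinDVRSettingLevelsTame (κ.unitTwist (-1)) hm π S hpS hbad L hL hLS jbar' cd Dd).KolyvaginSystem,
            κKS.one ≠ 0 ∧
            ∀ k, κKS.one k = I.proj (k + 1) (D.toEisensteinH1Linear hm t ht I hγ hE z)

/-! ## §2 The predicate of K2a from F-161′ and the link, unconditionally in everything else -/

set_option synthInstance.maxHeartbeats 80000 in
set_option maxHeartbeats 1600000 in
/-- **`Stmt.conclusionAtControlLevels 3 …` for the twin from Howard's Thm. 1.6.1 (F-161′, BY NAME) and the Kolyvagin-system link** —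
in the binders of crux 24737: `W′/ℚ` with `Rank1Residual.Mult W′ 3` and `ρ̄_{W′,3}` onto, `K` imaginary quadratic Heegner for `N′`,
`κ` anticyclotomic, `γ` a topological generator, a Heegner family `F` (Manin constant prime to `3`, `α² = 1`, norm-coherent), a `Λ`-adic
datum `Dat` and the `Λ`-adic Heegner class `z ≠ 0` of `F`.  x9's D1 chain (`howardInputs_of_clauses`) with the twin's `SatisfiesH`
theorem (p761918) and the generic `LargePrimes`; Thm. 1.6.1 gives `Conclusion hy κ₁`, and the link `κ₁ = (I.proj (k+1) (f_m z))_k`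
makes it the predicate. [cite: Howard2004HeegnerKolyvagin, Thm. 1.6.1, §1.3, §2.2–§2.3, proof of Thm. 2.2.10] -/
theorem twin_conclusionAtControlLevels_of_ksLink (h161 : Howard2004.thm161_dvrKolyvaginBound) (hKS : Stmt.ksLinkMultAt 3)
    (W' : WeierstrassCurve ℚ) [W'.IsElliptic] [W'.IsGloballyMinimal] (N' : ℕ) [NeZero N']
    (K : Type) [Field K] [NumberField K]
    (hm3 : Rank1Residual.Mult W' 3) (hsurj : W'.HasSurjectiveModNGaloisRep 3) (hK : IsImaginaryQuadratic K)
    (hH : SatisfiesHeegnerHypothesis N' K) (κ : ZpExtension K 3) (hκ : κ.IsAnticyclotomic)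
    (γ : absoluteGaloisGroup K) [hγ : Fact (κ.IsTopGenerator γ)]
    (jbar : AlgebraicClosure K →+* ℂ) (F : HeegnerFamily N' W' K κ jbar) (α : ℤ)
    (hc : ¬ (3 : ℤ) ∣ F.Dt.c) (hα : α ^ 2 = 1) (hcoh : F.IsNormCompatible γ α)
    (Dat : (W'.baseChange K).LambdaAdicSelmerData κ γ) (z : Dat.S) (hz : IsLambdaAdicHeegnerClass Dat F α z) (hz0 : z ≠ 0) :
    Stmt.conclusionAtControlLevels 3 N' W' K κ γ hγ.out
      (UniversalToricDescentTowerTorsion.baseChange_noPTorsion_of_surjective W' 3 hsurj K hK) Dat z := by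
  have hmultp : ∀ w : HeightOneSpectrum (𝓞 K), ((3 : ℕ) : 𝓞 K) ∈ w.asIdeal →
      (W'.baseChange K).HasMultiplicativeReductionAt w :=
    fun w hw ↦ UniversalToricDescentTwinTateLineAtThree.hasMultiplicativeReductionAt_baseChange_of_mult_three W' hm3 K w hw
  -- the KS side's set of places `S` and its threshold `m₁`
  obtain ⟨S, hpS, hbad, hSN, hSσ, m₁, hKSm⟩ := hKS N' W' K κ γ hK (by decide) hκ hH hγ.out
    (UniversalToricDescentTowerTorsion.baseChange_noPTorsion_of_surjective W' 3 hsurj K hK) hmultp jbar F α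
    (by exact_mod_cast hc) hα hcoh Dat z hz hz0
  -- the twin's `SatisfiesH` for the levels-tame settings over this `S`, `m ≫ 0` (g25, PROVED)
  obtain ⟨m₀, hHyp⟩ := UniversalToricDescentTwinSatisfiesHAtThree.exists_satisfiesH_levelsTame_of_mult_three N' W' K κ hm3 hsurj
    hK hH hκ S hpS hbad hSN hSσ
  refine ⟨max m₀ m₁, fun m hm hle ↦ ?_⟩
  have hle₀ : m₀ ≤ m := le_trans (le_max_left _ _) hle
  have hle₁ : m₁ ≤ m := le_trans (le_max_right _ _) hle
  letI := IwasawaAlgebra.isDomain_quotient_X_pow_add_C 3 hm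
  letI := IwasawaAlgebra.isDiscreteValuationRing_quotient_X_pow_add_C 3 hm
  haveI := IwasawaAlgebra.EisensteinCoeff.isLocalRing_succ 3 hm
  letI := IwasawaAlgebra.EisensteinCoeff.algebraOfSpecSucc 3 m
  haveI := W'.isScalarTower_algebraOfSpecSucc (K := K) (p := 3) (m := m)
  letI := W'.residueModuleSucc (K := K) (p := 3) hm
  -- the KS side's choices at `m`
  obtain ⟨π, L, hL, hLS, s₁, hsub, t, ht, I, jbar', hKS'⟩ := hKSm m hm hle₁
  -- the canonical conjugation datum, H.4 data and `SatisfiesH`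
  obtain ⟨c₀, σ, hσ₁, hσ, hτl, hτ₂, Dd, hy⟩ := hHyp m hm hle₀ π L hL hLS jbar'
  obtain ⟨κKS, hone, hlink⟩ := hKS' _ Dd hy
  have hLP := W'.eisensteinDVRSetting_largePrimes (κ.unitTwist (-1)) hm S hpS hbad L hL hLS jbar' _ Dd
    (W'.eisensteinLevelsTameFs (κ.unitTwist (-1)) hm π S hpS hbad L hL hLS) hsub
  -- Howard's Thm. 1.6.1 (F-161′, by name) at this setting and Kolyvagin system
  have hconc := h161 3 K _ _ _ _ _ _ κKS hy hLP hone
  have hone_eq : κKS.one = fun k ↦ I.proj (k + 1) (Dat.toEisensteinH1Linear hm t ht I hγ.out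
      (UniversalToricDescentTowerTorsion.baseChange_noPTorsion_of_surjective W' 3 hsurj K hK) z) := funext hlink
  rw [hone_eq] at hconc
  exact ⟨S, hpS, hbad, hSN, hSσ, L, hL, hLS, jbar', _, Dd,
    W'.eisensteinLevelsTameFs (κ.unitTwist (-1)) hm π S hpS hbad L hL hLS, t, ht, I, hy, hconc⟩

end Summit.BirchSwinnertonDyer.BirchSwinnertonDyer.Theorems.UniversalToricDescentTwinHowardConclusionOfKS

end
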